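import Summits.AtomisticToContinuum.Crystallization.Theorems.ChargedEnergyGapCapCell
import HarnessLib

/-!
# WeightEnv (lens-3 g90, NODE 103) — from a δ-affine DEPTH envelope to a δ-affine WEIGHT envelope (cost-side «env» row replay)

Second cost-side piece (after NODE 102 `SqrtTangent`).  NODE 102 certifies, per vertex `v` of the designated hole and per census cell, a two-sided
affine envelope of the depth along the cell displacement `δ`: `d₀ + g₀·b − E ≤ d_v ≤ d₀ + g₀·b + E` with `b = ∇Q_v(z₀)·δ` linear in `δ`, `|b| ≤ bmax`.
This file turns it into the WEIGHT row the cell LP consumes, `pL + qL·b ≤ φ(d_v) ≤ pU + qU·b` (`φ = depthProfile 160`), using only tree facts: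
`φ` monotone (`depthProfile_monotone`, NODE 94), the chord majorant on `[dlo, dhi] ⊆ [80, 134]` (`pole_row_cell` / `PoleRowCert`, NODE 99 ← NODE 97)
and the secant minorant through `a' < dlo` (`depthProfile_secant_lower`, NODE 97).
* `WeightEnvCert a' dlo dhi d₀ g₀ E bmax p₀ p₁ pL qL : Prop` — the closed rational side conditions (interval bookkeeping, `PoleRowCert`-shaped chord
  certificate with `0 ≤ p₁`, and the two ENDPOINT checks `b = ±bmax` of the lower line against the secant composed with the lower depth envelope);
* `affine_nonneg_of_endpoints_pm` (an affine function of `b` non-negative at `±bmax` is non-negative on `[−bmax, bmax]`);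
* ★ `weight_env_row (hC : WeightEnvCert …) (hb : |b| ≤ bmax) (hd : d₀ + g₀·b − E ≤ d ∧ d ≤ d₀ + g₀·b + E) :
      pL + qL·b ≤ φ d ∧ φ d ≤ (p₀ + p₁·(d₀ + E)) + (p₁·g₀)·b`   — the upper row is EXPLICIT (no corner check), the lower row is certified by `hC`.
Census usage: `weight_env_row (by norm_num [WeightEnvCert, depthProfile, smoothStep, min_def, max_def]) hb (sqrt_cell_env …)`.
-/

noncomputable section
open scoped Classical
open Literature.MathematicalPhysics.StatisticalMechanics Literature.Geometry.DiscreteGeometry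
open Summit.AtomisticToContinuum.Crystallization.Theses.PricedLinkCensus
open Summit.AtomisticToContinuum.Crystallization.Theorems.ChargedEnergyGapNegative

namespace Summit.AtomisticToContinuum.Crystallization.Theorems.ChargedEnergyGapChartDial

/-- An affine function of `b` that is non-negative at `b = ±bmax` is non-negative on `[−bmax, bmax]`. -/
theorem affine_nonneg_of_endpoints_pm {K M b bmax : ℝ} (hbmax : 0 < bmax) (hLp : 0 ≤ K + M * bmax) (hLm : 0 ≤ K - M * bmax)
    (hb₁ : -bmax ≤ b) (hb₂ : b ≤ bmax) : 0 ≤ K + M * b := by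
  have h1 : 0 ≤ (bmax - b) * (K - M * bmax) := mul_nonneg (by linarith) hLm
  have h2 : 0 ≤ (bmax + b) * (K + M * bmax) := mul_nonneg (by linarith) hLp
  nlinarith

/-- ★ The WEIGHT-ROW CERTIFICATE of a vertex on a cell (all entries rational in the census): `a' < dlo < dhi` in `[80, 134]` with the depth band
`[d₀ − g₀·bmax − E, d₀ + g₀·bmax + E] ⊆ [dlo, dhi]`, `0 ≤ g₀`, `0 < bmax`; the chord certificate `φ(dlo) ≤ p₀ + p₁·dlo`, `φ(dhi) ≤ p₀ + p₁·dhi`, `0 ≤ p₁`;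
and the lower line `pL + qL·b` below the secant (through `a'`, `dlo`) composed with the lower depth envelope, checked at `b = ±bmax`. -/
def WeightEnvCert (a' dlo dhi d₀ g₀ E bmax p₀ p₁ pL qL : ℝ) : Prop :=
  0 ≤ g₀ ∧ 0 < bmax ∧ 80 ≤ a' ∧ a' < dlo ∧ dlo < dhi ∧ dhi ≤ 134 ∧
  dlo ≤ d₀ - g₀ * bmax - E ∧ d₀ + g₀ * bmax + E ≤ dhi ∧
  depthProfile 160 dlo ≤ p₀ + p₁ * dlo ∧ depthProfile 160 dhi ≤ p₀ + p₁ * dhi ∧ 0 ≤ p₁ ∧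
  pL + qL * bmax ≤ depthProfile 160 a' + (depthProfile 160 dlo - depthProfile 160 a') / (dlo - a') * (d₀ + g₀ * bmax - E - a') ∧
  pL - qL * bmax ≤ depthProfile 160 a' + (depthProfile 160 dlo - depthProfile 160 a') / (dlo - a') * (d₀ - g₀ * bmax - E - a')

/-- ★★ THE WEIGHT «env» ROW: from the depth envelope `d₀ + g₀·b ∓ E` (NODE 102) to `pL + qL·b ≤ φ(d) ≤ (p₀ + p₁(d₀+E)) + (p₁ g₀)·b`. -/
theorem weight_env_row {a' dlo dhi d₀ g₀ E bmax p₀ p₁ pL qL : ℝ} (hC : WeightEnvCert a' dlo dhi d₀ g₀ E bmax p₀ p₁ pL qL)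
    {d b : ℝ} (hb : |b| ≤ bmax) (hd : d₀ + g₀ * b - E ≤ d ∧ d ≤ d₀ + g₀ * b + E) :
    pL + qL * b ≤ depthProfile 160 d ∧ depthProfile 160 d ≤ (p₀ + p₁ * (d₀ + E)) + (p₁ * g₀) * b := by
  obtain ⟨hg, hbmax, ha, halo, hlt, hhi, hlo_env, hhi_env, hPlo, hPhi, hp₁, hLp2, hLm2⟩ := hC
  obtain ⟨hb₁, hb₂⟩ := abs_le.1 hb
  obtain ⟨hdl, hdu⟩ := hd
  have hgb₁ : -(g₀ * bmax) ≤ g₀ * b := by nlinarith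
  have hgb₂ : g₀ * b ≤ g₀ * bmax := by nlinarith
  -- the depth band
  have hℓlo : dlo ≤ d₀ + g₀ * b - E := by linarith
  have hdlo : dlo ≤ d := by linarith
  have hdhi : d ≤ dhi := by linarith
  have hℓhi : d₀ + g₀ * b - E ≤ dhi := by linarith
  constructor
  · -- lower: monotone φ, then the secant minorant at the lower envelope point, then the certified line
    have hmono : depthProfile 160 (d₀ + g₀ * b - E) ≤ depthProfile 160 d :=
      depthProfile_monotone (by norm_num : (0 : ℝ) < 160) hdl
    have hsec := depthProfile_secant_lower ha halo hhi (d₀ + g₀ * b - E) hℓlo hℓhi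
    set sl := (depthProfile 160 dlo - depthProfile 160 a') / (dlo - a') with hsl
    have ep : sl * (d₀ + g₀ * bmax - E - a') = sl * (d₀ - E - a') + (sl * g₀) * bmax := by ring
    have em : sl * (d₀ - g₀ * bmax - E - a') = sl * (d₀ - E - a') - (sl * g₀) * bmax := by ring
    have e0 : sl * (d₀ + g₀ * b - E - a') = sl * (d₀ - E - a') + (sl * g₀) * b := by ring
    have hK := affine_nonneg_of_endpoints_pm (K := depthProfile 160 a' + sl * (d₀ - E - a') - pL) (M := sl * g₀ - qL) hbmax
      (by linarith) (by linarith) hb₁ hb₂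
    linarith
  · -- upper: chord majorant at d, then monotone in the affine argument (p₁ ≥ 0)
    have hch := pole_row_cell (by linarith) hlt hhi ⟨hPlo, hPhi⟩ d hdlo hdhi
    have : p₁ * d ≤ p₁ * (d₀ + g₀ * b + E) := mul_le_mul_of_nonneg_left hdu hp₁
    linarith

end Summit.AtomisticToContinuum.Crystallization.Theorems.ChargedEnergyGapChartDial

end
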